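import Mathlib
import Summits.MatrixMultiplication.MatrixMultiplication.Theses.LevelGradedCohnUmans
import Summits.MatrixMultiplication.MatrixMultiplication.Theorems.LevelGradedCohnUmansSubgroupIdentityDesignsStubLevelMul
import Summits.MatrixMultiplication.MatrixMultiplication.Theorems.LevelGradedCohnUmansSubgroupIdentityDesignsStubColFix
-- TODO(re-import once the farm has built them; landed p87169, p88574, p88957):
-- import Summits.MatrixMultiplication.MatrixMultiplication.Theorems.LevelGradedCohnUmansSubgroupIdentityDesignsStubRowFix
-- import Summits.MatrixMultiplication.MatrixMultiplication.Theorems.LevelGradedCohnUmansSubgroupIdentityDesignsStubPolyOfLevels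
-- import Summits.MatrixMultiplication.MatrixMultiplication.Theorems.LevelGradedCohnUmansSubgroupIdentityDesignsStubRadialMonomial
import Literature.Barriers.MatrixMultiplication.NormalizerBarrier

/-!
# Line `SketchIdeator3G2` (witness-subgroup four-fold TPP) for the crux `SubgroupIdentityDesigns`
(stmt-MatrixMultiplication-14079) — the lead's skeleton

Composition idea (card `Ideas/witness-subgroup-fourfold-tpp.md`): NAME the identity test.  For a
fourth subgroup `Q ≤ GL_m(𝔽_p)` the indicator `1_Q` has `1_Q(1) = 1` and vanishes on
`H₁H₂H₃ ∖ 1` exactly when `(H₁,H₂,H₃;Q)` has the FOUR-FOLD trivial-product property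
`a b c q = 1 ⇒ a = b = c = q = 1`; and for the frame–coframe stabilisers
`Q_{a,b} = {g : the first a columns of g are unit columns, the last b rows are unit rows}` the
indicator `1_{Q_{a,b}}` is a product of `a + b` single-column / single-row indicators, each of
Fourier level `1`, hence lies in the level-`(a+b)` test space `F_{a+b}`.  So a witnessed quadruple
beating the level-`(a+b)` budget is a witness of the crux.

Stubs (registered): LANDED — `stub_levelMul` (p86275; levels add under pointwise products),
`stub_colFix` (p86524; single-column indicator has level `1`), `stub_rowFix` (p87169; single-row
indicator has level `1`), `stub_polyOfLevels` (p88574) and `stub_radialMonomial` (p88957) — the radial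
branch (line `Sketch` merged in as an alternative transfer): polynomial interpolation on a statistic
with level-`k` powers, and `(p^{-rk(g-1)})^j ∈ F_k` for `j ≤ k`.  The first two are imported from
`Theorems/`; the last three are kept below as `sorry` copies ONLY until the farm has built their
modules (then import + delete).  OPEN:
* `stub_witnessedOrSparse` — the lead's own stub: C⁺_W ∨ C⁺_R, where C⁺_W = `WitnessedLieDesigns`
  (a four-fold-TPP quadruple `(H₁,H₂,H₃; Q_{a,b})` beating the level-`(a+b)` budget, for every `ε`) and
  C⁺_R = `SparseSpectrumDesigns` (a TPP triple with `k`-sparse non-zero rank spectrum beating the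
  level-`k` budget, for every `ε`).
Everything else (four-fold TPP ⇒ TPP and ⇒ the `0/1` pattern of `1_Q`, `Q_{a,b}` as a subgroup,
`1_{Q_{a,b}} ∈ F_{a+b}` from the three Fourier stubs, the transfer to the crux BY NAME) is proved here.
-/

set_option linter.dupNamespace false

noncomputable section

open scoped BigOperators Classical
open Literature.Barriers.MatrixMultiplication

namespace Summit.MatrixMultiplication.MatrixMultiplication.Theorems.Witnessed

open Summit.MatrixMultiplication.MatrixMultiplication.Theses.LevelGradedCohnUmans

/-- `GL_m(𝔽_p)` as in the crux. -/
abbrev GLm (p m : ℕ) : Type := Matrix.GeneralLinearGroup (Fin m) (ZMod p)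

/-- `M_m(𝔽_p)`, the Fourier side. -/
abbrev Mat (p m : ℕ) : Type := Matrix (Fin m) (Fin m) (ZMod p)

/-- `f : GL_m(𝔽_p) → ℂ` has FOURIER LEVEL `≤ k`: `f(g) = Σ_M c_M ψ(tr(M g))` with a coefficient table
`c` vanishing on matrices of rank `> k` (`ψ = ZMod.stdAddChar`).  This is LITERALLY the set-builder
predicate of the crux's budget set `Irr ∩ F_k`. -/
def IsLevel (p m : ℕ) [Fact p.Prime] (k : ℕ) (f : GLm p m → ℂ) : Prop :=
  ∃ c : Matrix (Fin m) (Fin m) (ZMod p) → ℂ, (∀ M, k < M.rank → c M = 0) ∧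
    ∀ g : Matrix.GeneralLinearGroup (Fin m) (ZMod p), f g =
      ∑ M : Matrix (Fin m) (Fin m) (ZMod p),
        c M * ZMod.stdAddChar (Matrix.trace (M * (g : Matrix (Fin m) (Fin m) (ZMod p))))

/-- **Four-fold trivial-product property** of a quadruple of subgroups:
`a b c q = 1` (`a ∈ H₁, b ∈ H₂, c ∈ H₃, q ∈ Q`) forces `a = b = c = q = 1`. -/
def FourFoldTPP {G : Type*} [Group G] (H₁ H₂ H₃ Q : Subgroup G) : Prop :=
  ∀ a ∈ H₁, ∀ b ∈ H₂, ∀ c ∈ H₃, ∀ q ∈ Q, a * b * c * q = 1 → a = 1 ∧ b = 1 ∧ c = 1 ∧ q = 1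

section FourFold

variable {G : Type*} [Group G] {H₁ H₂ H₃ Q : Subgroup G}

/-- Four-fold TPP ⇒ the subgroup TPP of the first three groups (`q = 1`). -/
theorem FourFoldTPP.subgroupTPP (h : FourFoldTPP H₁ H₂ H₃ Q) : SubgroupTPP H₁ H₂ H₃ := by
  intro a ha b hb c hc habc
  obtain ⟨h1, h2, h3, -⟩ := h a ha b hb c hc 1 Q.one_mem (by simpa using habc)
  exact ⟨h1, h2, h3⟩

/-- Four-fold TPP ⇒ a non-trivial triple product `a b c` avoids `Q`. -/
theorem FourFoldTPP.not_mem (h : FourFoldTPP H₁ H₂ H₃ Q) {a b c : G} (ha : a ∈ H₁) (hb : b ∈ H₂)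
    (hc : c ∈ H₃) (hne : a * b * c ≠ 1) : a * b * c ∉ Q := by
  intro hq
  have hq' : (a * b * c)⁻¹ ∈ Q := Q.inv_mem hq
  obtain ⟨h1, h2, h3, -⟩ := h a ha b hb c hc _ hq' (by rw [mul_inv_cancel])
  exact hne (by rw [h1, h2, h3, one_mul, one_mul])

end FourFold

variable {p m : ℕ}

/-- The FRAME–COFRAME STABILISER `Q_{a,b} ≤ GL_m(𝔽_p)`: matrices whose first `a` columns are the
unit columns `e_j` (`j < a`) and whose last `b` rows are the unit rows `e_iᵀ` (`m - b ≤ i`), i.e. the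
pointwise stabiliser of the `a`-frame `(e_0,…,e_{a-1})` and of the `b`-coframe `(e_{m-b}ᵀ,…,e_{m-1}ᵀ)`. -/
def frameCoframeStab (p m a b : ℕ) : Subgroup (GLm p m) where
  carrier := {g | (∀ i j : Fin m, j.val < a → (g : Mat p m) i j = (1 : Mat p m) i j) ∧
    (∀ i j : Fin m, m - b ≤ i.val → (g : Mat p m) i j = (1 : Mat p m) i j)}
  one_mem' := by
    simp only [Set.mem_setOf_eq, Units.val_one, implies_true, and_self]
  mul_mem' := by
    intro g h hg hh
    refine ⟨fun i j hj => ?_, fun i j hi => ?_⟩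
    · rw [Units.val_mul, Matrix.mul_apply]
      calc ∑ l, (g : Mat p m) i l * (h : Mat p m) l j
          = ∑ l, (g : Mat p m) i l * (1 : Mat p m) l j :=
            Finset.sum_congr rfl fun l _ => by rw [hh.1 l j hj]
        _ = (g : Mat p m) i j := by rw [← Matrix.mul_apply, Matrix.mul_one]
        _ = (1 : Mat p m) i j := hg.1 i j hj
    · rw [Units.val_mul, Matrix.mul_apply]
      calc ∑ l, (g : Mat p m) i l * (h : Mat p m) l j
          = ∑ l, (1 : Mat p m) i l * (h : Mat p m) l j :=
            Finset.sum_congr rfl fun l _ => by rw [hg.2 i l hi]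
        _ = (h : Mat p m) i j := by rw [← Matrix.mul_apply, Matrix.one_mul]
        _ = (1 : Mat p m) i j := hh.2 i j hi
  inv_mem' := by
    intro g hg
    refine ⟨fun i j hj => ?_, fun i j hi => ?_⟩
    · -- `1 = g⁻¹ g`, and column `j` of `g` is `e_j`
      have h1 : (1 : Mat p m) i j = ((g⁻¹ : GLm p m) : Mat p m) i j := by
        rw [← Units.inv_mul, Matrix.mul_apply]
        calc ∑ l, ((g⁻¹ : GLm p m) : Mat p m) i l * (g : Mat p m) l j
            = ∑ l, ((g⁻¹ : GLm p m) : Mat p m) i l * (1 : Mat p m) l j :=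
              Finset.sum_congr rfl fun l _ => by rw [hg.1 l j hj]
          _ = ((g⁻¹ : GLm p m) : Mat p m) i j := by rw [← Matrix.mul_apply, Matrix.mul_one]
      exact h1.symm
    · have h1 : (1 : Mat p m) i j = ((g⁻¹ : GLm p m) : Mat p m) i j := by
        rw [← Units.mul_inv, Matrix.mul_apply]
        calc ∑ l, (g : Mat p m) i l * ((g⁻¹ : GLm p m) : Mat p m) l j
            = ∑ l, (1 : Mat p m) i l * ((g⁻¹ : GLm p m) : Mat p m) l j :=
              Finset.sum_congr rfl fun l _ => by rw [hg.2 i l hi]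
          _ = ((g⁻¹ : GLm p m) : Mat p m) i j := by rw [← Matrix.mul_apply, Matrix.one_mul]
      exact h1.symm

/-- Membership in `Q_{a,b}`, unfolded. -/
theorem mem_frameCoframeStab_iff {a b : ℕ} (g : GLm p m) :
    g ∈ frameCoframeStab p m a b ↔
      (∀ i j : Fin m, j.val < a → (g : Mat p m) i j = (1 : Mat p m) i j) ∧
        (∀ i j : Fin m, m - b ≤ i.val → (g : Mat p m) i j = (1 : Mat p m) i j) :=
  Iff.rfl

/-! ## The three Fourier stubs and their consequences -/

section Fourier

variable [Fact p.Prime]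

-- `stub_levelMul` (levels add under pointwise products): LANDED, p86275,
-- Theorems/LevelGradedCohnUmansSubgroupIdentityDesignsStubLevelMul.lean (imported above).

-- `stub_colFix` (single-column indicator has level 1): LANDED, p86524,
-- Theorems/LevelGradedCohnUmansSubgroupIdentityDesignsStubColFix.lean (imported above).

/-- LANDED as `Witnessed.stub_rowFix` (p87169, Theorems/…StubRowFix.lean); kept here as a `sorry`
until the farm has built that module (then: import it and delete this copy).  Single-row indicator
has level `1`. -/
theorem stub_rowFix (i : Fin m) :
    ∃ c : Matrix (Fin m) (Fin m) (ZMod p) → ℂ, (∀ M, 1 < M.rank → c M = 0) ∧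
      ∀ g : Matrix.GeneralLinearGroup (Fin m) (ZMod p),
        (if ∀ j : Fin m, (g : Matrix (Fin m) (Fin m) (ZMod p)) i j =
            (1 : Matrix (Fin m) (Fin m) (ZMod p)) i j then (1 : ℂ) else 0) =
          ∑ M : Matrix (Fin m) (Fin m) (ZMod p),
            c M * ZMod.stdAddChar (Matrix.trace (M * (g : Matrix (Fin m) (Fin m) (ZMod p)))) := by
  sorry

/-- `IsLevel` form of `stub_levelMul` (definitional repackaging): levels add under products. -/
theorem isLevel_mul {a b : ℕ} {f f' : GLm p m → ℂ} (hf : IsLevel p m a f)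
    (hf' : IsLevel p m b f') : IsLevel p m (a + b) (fun g => f g * f' g) :=
  stub_levelMul hf hf'

/-- `IsLevel` form of `stub_colFix`: the single-column indicator has level `1`. -/
theorem isLevel_colFix (j : Fin m) :
    IsLevel p m 1 (fun g => if ∀ i : Fin m, (g : Mat p m) i j = (1 : Mat p m) i j then 1 else 0) :=
  stub_colFix j

/-- `IsLevel` form of `stub_rowFix`: the single-row indicator has level `1`. -/
theorem isLevel_rowFix (i : Fin m) :
    IsLevel p m 1 (fun g => if ∀ j : Fin m, (g : Mat p m) i j = (1 : Mat p m) i j then 1 else 0) :=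
  stub_rowFix i

/-- Level is monotone in `k`. -/
theorem IsLevel.mono {k k' : ℕ} (hk : k ≤ k') {f : GLm p m → ℂ} (hf : IsLevel p m k f) :
    IsLevel p m k' f := by
  obtain ⟨c, hc, hf⟩ := hf
  exact ⟨c, fun M hM => hc M (lt_of_le_of_lt hk hM), hf⟩

/-- The constant function `1` has level `0` (the single mode `M = 0`). -/
theorem isLevel_const_one : IsLevel p m 0 (fun _ => (1 : ℂ)) := by
  refine ⟨fun M => if M = 0 then 1 else 0, fun M hM => ?_, fun g => ?_⟩
  · have hM0 : M ≠ 0 := by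
      rintro rfl
      simp at hM
    exact if_neg hM0
  · rw [Finset.sum_eq_single (0 : Mat p m)]
    · simp
    · intro M _ hM
      simp [hM]
    · intro h
      exact absurd (Finset.mem_univ _) h

/-- Levels add along finite products of level-`1` functions. -/
theorem isLevel_prod {ι : Type*} (s : Finset ι) (f : ι → GLm p m → ℂ)
    (hf : ∀ i ∈ s, IsLevel p m 1 (f i)) :
    IsLevel p m s.card (fun g => ∏ i ∈ s, f i g) := by
  classical
  induction s using Finset.induction_on with
  | empty => simpa using (isLevel_const_one (p := p) (m := m))
  | @insert i s hi ih =>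
    have h1 : IsLevel p m 1 (f i) := hf i (Finset.mem_insert_self i s)
    have h2 : IsLevel p m s.card (fun g => ∏ i ∈ s, f i g) :=
      ih fun i' hi' => hf i' (Finset.mem_insert_of_mem hi')
    have h12 := isLevel_mul h1 h2
    rw [Finset.card_insert_of_notMem hi, Nat.add_comm]
    refine (IsLevel.mono le_rfl ?_)
    convert h12 using 2 with g
    rw [Finset.prod_insert hi]

/-- The indicator of `Q_{a,b}`. -/
def qInd (p m a b : ℕ) (g : GLm p m) : ℂ := if g ∈ frameCoframeStab p m a b then 1 else 0

/-- The indicator of `Q_{a,b}` as a product of single-column and single-row indicators. -/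
theorem qInd_eq_prod (a b : ℕ) (g : GLm p m) :
    qInd p m a b g =
      (∏ j ∈ (Finset.univ.filter fun j : Fin m => j.val < a),
          (if ∀ i : Fin m, (g : Mat p m) i j = (1 : Mat p m) i j then (1 : ℂ) else 0)) *
        ∏ i ∈ (Finset.univ.filter fun i : Fin m => m - b ≤ i.val),
          (if ∀ j : Fin m, (g : Mat p m) i j = (1 : Mat p m) i j then (1 : ℂ) else 0) := by
  unfold qInd
  by_cases hg : g ∈ frameCoframeStab p m a b
  · rw [if_pos hg]
    rw [mem_frameCoframeStab_iff] at hg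
    have e1 : (∏ j ∈ (Finset.univ.filter fun j : Fin m => j.val < a),
        (if ∀ i : Fin m, (g : Mat p m) i j = (1 : Mat p m) i j then (1 : ℂ) else 0)) = 1 := by
      refine Finset.prod_eq_one fun j hj => ?_
      simp only [Finset.mem_filter, Finset.mem_univ, true_and] at hj
      exact if_pos fun i => hg.1 i j hj
    have e2 : (∏ i ∈ (Finset.univ.filter fun i : Fin m => m - b ≤ i.val),
        (if ∀ j : Fin m, (g : Mat p m) i j = (1 : Mat p m) i j then (1 : ℂ) else 0)) = 1 := by
      refine Finset.prod_eq_one fun i hi => ?_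
      simp only [Finset.mem_filter, Finset.mem_univ, true_and] at hi
      exact if_pos fun j => hg.2 i j hi
    rw [e1, e2, one_mul]
  · rw [if_neg hg]
    rw [mem_frameCoframeStab_iff, not_and_or] at hg
    rcases hg with h1 | h2
    · push Not at h1
      obtain ⟨i, j, hj, hne⟩ := h1
      have e1 : (∏ j ∈ (Finset.univ.filter fun j : Fin m => j.val < a),
          (if ∀ i : Fin m, (g : Mat p m) i j = (1 : Mat p m) i j then (1 : ℂ) else 0)) = 0 := by
        refine Finset.prod_eq_zero (i := j) (by simp [hj]) ?_
        exact if_neg fun h => hne (h i)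
      rw [e1, zero_mul]
    · push Not at h2
      obtain ⟨i, j, hi, hne⟩ := h2
      have e2 : (∏ i ∈ (Finset.univ.filter fun i : Fin m => m - b ≤ i.val),
          (if ∀ j : Fin m, (g : Mat p m) i j = (1 : Mat p m) i j then (1 : ℂ) else 0)) = 0 := by
        refine Finset.prod_eq_zero (i := i)
          (by simp only [Finset.mem_filter, Finset.mem_univ, true_and]; exact hi) ?_
        exact if_neg fun h => hne (h j)
      rw [e2, mul_zero]

/-- **`IndicatorInLevel`**: `1_{Q_{a,b}} ∈ F_{a+b}` (from the three Fourier stubs). -/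
theorem qInd_isLevel (a b : ℕ) : IsLevel p m (a + b) (qInd p m a b) := by
  have hcol : IsLevel p m (Finset.univ.filter fun j : Fin m => j.val < a).card
      (fun g => ∏ j ∈ (Finset.univ.filter fun j : Fin m => j.val < a),
        (if ∀ i : Fin m, (g : Mat p m) i j = (1 : Mat p m) i j then (1 : ℂ) else 0)) :=
    isLevel_prod _ _ fun j _ => isLevel_colFix j
  have hrow : IsLevel p m (Finset.univ.filter fun i : Fin m => m - b ≤ i.val).card
      (fun g => ∏ i ∈ (Finset.univ.filter fun i : Fin m => m - b ≤ i.val),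
        (if ∀ j : Fin m, (g : Mat p m) i j = (1 : Mat p m) i j then (1 : ℂ) else 0)) :=
    isLevel_prod _ _ fun i _ => isLevel_rowFix i
  have hprod := isLevel_mul hcol hrow
  -- count the constrained columns / rows
  have hca : (Finset.univ.filter fun j : Fin m => j.val < a).card ≤ a := by
    calc (Finset.univ.filter fun j : Fin m => j.val < a).card
        = ((Finset.univ.filter fun j : Fin m => j.val < a).image fun j : Fin m => j.val).card := by
          rw [Finset.card_image_of_injective _ Fin.val_injective]
      _ ≤ (Finset.range a).card := by
          refine Finset.card_le_card ?_
          intro x hx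
          simp only [Finset.mem_image, Finset.mem_filter, Finset.mem_univ, true_and] at hx
          obtain ⟨j, hj, rfl⟩ := hx
          simpa using hj
      _ = a := Finset.card_range a
  have hcb : (Finset.univ.filter fun i : Fin m => m - b ≤ i.val).card ≤ b := by
    calc (Finset.univ.filter fun i : Fin m => m - b ≤ i.val).card
        = ((Finset.univ.filter fun i : Fin m => m - b ≤ i.val).image
            fun i : Fin m => i.val - (m - b)).card := by
          rw [Finset.card_image_of_injOn]
          intro x hx y hy hxy
          simp only [Finset.coe_filter, Finset.mem_univ, true_and, Set.mem_setOf_eq] at hx hy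
          apply Fin.ext
          have := hxy
          simp only at this
          omega
      _ ≤ (Finset.range b).card := by
          refine Finset.card_le_card ?_
          intro x hx
          simp only [Finset.mem_image, Finset.mem_filter, Finset.mem_univ, true_and] at hx
          obtain ⟨i, hi, rfl⟩ := hx
          simp only [Finset.mem_range]
          have := i.isLt
          omega
      _ = b := Finset.card_range b
  refine IsLevel.mono (Nat.add_le_add hca hcb) ?_
  convert hprod using 2 with g
  exact qInd_eq_prod a b g

end Fourier

/-! ## The radial branch (line `Sketch`, merged as an alternative transfer): two def-free stubs -/

section Radial

variable [Fact p.Prime]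

/-- LANDED as `Witnessed.stub_radialMonomial` (p88957, Theorems/…StubRadialMonomial.lean); kept here as a
`sorry` until the farm has built that module (then: import it and delete this copy).
STUB (radial monomial; Mathlib notions only).  For `j ≤ k` the rank statistic
`g ↦ (p^{-rk(g-1)})^j` has Fourier level `≤ k`:  `p^{-j·rk(g-1)} = p^{-jm} · #{E ∈ M_{j×m}(𝔽_p) : E (g-1) = 0}`
and `[E(g-1) = 0] = p^{-jm} Σ_{C ∈ M_{m×j}} ψ(tr(C E g)) ψ(-tr(C E))`, whose modes `C E` have rank `≤ j`
(Delsarte's bilinear-forms eigenfunctions; card `rank-spectrum-radial-separators`). -/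
theorem stub_radialMonomial {k j : ℕ} (hj : j ≤ k) :
    ∃ c : Matrix (Fin m) (Fin m) (ZMod p) → ℂ, (∀ M, k < M.rank → c M = 0) ∧
      ∀ g : Matrix.GeneralLinearGroup (Fin m) (ZMod p),
        (((p : ℂ)⁻¹) ^ ((g : Matrix (Fin m) (Fin m) (ZMod p)) - 1).rank) ^ j =
          ∑ M : Matrix (Fin m) (Fin m) (ZMod p),
            c M * ZMod.stdAddChar (Matrix.trace (M * (g : Matrix (Fin m) (Fin m) (ZMod p)))) := by
  sorry

/-- LANDED as `Witnessed.stub_polyOfLevels` (p88574, Theorems/…StubPolyOfLevels.lean); kept here as a `sorry`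
until the farm has built that module (then: import it and delete this copy).
STUB (polynomial interpolation on a statistic whose powers have level `≤ k`; Mathlib notions
only).  If `x : GL_m(𝔽_p) → ℂ` has all powers `x^j` (`j ≤ k`) of level `≤ k`, and `R` is a set of at
most `k` "forbidden values" not containing `x 1`, then some level-`k` function is `1` at the identity
and `0` wherever `x g ∈ R`: take `P(X) = Π_{r ∈ R} (X - r)` (degree `≤ k`) and `f = P(x g)/P(x 1)`,
expanded in the powers `x^j`. -/
theorem stub_polyOfLevels {k : ℕ} (x : Matrix.GeneralLinearGroup (Fin m) (ZMod p) → ℂ)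
    (hx : ∀ j : ℕ, j ≤ k → ∃ c : Matrix (Fin m) (Fin m) (ZMod p) → ℂ, (∀ M, k < M.rank → c M = 0) ∧
      ∀ g : Matrix.GeneralLinearGroup (Fin m) (ZMod p), x g ^ j =
        ∑ M : Matrix (Fin m) (Fin m) (ZMod p),
          c M * ZMod.stdAddChar (Matrix.trace (M * (g : Matrix (Fin m) (Fin m) (ZMod p)))))
    (R : Finset ℂ) (hR : R.card ≤ k) (h1 : x 1 ∉ R) :
    ∃ c : Matrix (Fin m) (Fin m) (ZMod p) → ℂ, (∀ M, k < M.rank → c M = 0) ∧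
      (∑ M : Matrix (Fin m) (Fin m) (ZMod p), c M * ZMod.stdAddChar (Matrix.trace
          (M * ((1 : Matrix.GeneralLinearGroup (Fin m) (ZMod p)) : Matrix (Fin m) (Fin m) (ZMod p))))) = 1 ∧
      ∀ g : Matrix.GeneralLinearGroup (Fin m) (ZMod p), x g ∈ R →
        (∑ M : Matrix (Fin m) (Fin m) (ZMod p),
          c M * ZMod.stdAddChar (Matrix.trace (M * (g : Matrix (Fin m) (Fin m) (ZMod p))))) = 0 := by
  sorry

/-- The rank statistic `x(g) = p^{-rk(g-1)}` as a complex number. -/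
def rankStat (p m : ℕ) (g : GLm p m) : ℂ := ((p : ℂ)⁻¹) ^ ((g : Mat p m) - 1).rank

/-- `x(1) = 1`. -/
theorem rankStat_one : rankStat p m 1 = 1 := by
  simp [rankStat]

/-- `p^{-r} ≠ 1` for `r ≠ 0` (as `‖p⁻¹‖ < 1`). -/
theorem inv_pow_ne_one {r : ℕ} (hr : r ≠ 0) : ((p : ℂ)⁻¹) ^ r ≠ 1 := by
  have hp : (1 : ℝ) < p := by exact_mod_cast (Fact.out : p.Prime).one_lt
  intro h
  have hn : ‖((p : ℂ)⁻¹) ^ r‖ = 1 := by rw [h, norm_one]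
  rw [norm_pow, norm_inv, Complex.norm_natCast] at hn
  have hlt : ((p : ℝ)⁻¹) ^ r < 1 := pow_lt_one₀ (by positivity) (inv_lt_one_of_one_lt₀ hp) hr
  exact absurd hn (ne_of_lt hlt)

/-- **Sparse spectrum ⇒ identity test** (from the two radial stubs): if every non-trivial triple
product `s = abc` has `rk(s - 1) ∈ R` with `|R| ≤ k` and `0 ∉ R`, there is ONE level-`k` Fourier
function equal to `1` at the identity and `0` on the other triple products. -/
theorem identityTest_of_sparseSpectrum {k : ℕ} (H₁ H₂ H₃ : Subgroup (GLm p m))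
    (R : Finset ℕ) (hR : R.card ≤ k) (h0 : 0 ∉ R)
    (hS : ∀ a ∈ H₁, ∀ b ∈ H₂, ∀ c ∈ H₃, a * b * c ≠ 1 →
      (((a * b * c : GLm p m) : Mat p m) - 1).rank ∈ R) :
    ∃ c : Matrix (Fin m) (Fin m) (ZMod p) → ℂ, (∀ M, k < M.rank → c M = 0) ∧
      (∑ M : Matrix (Fin m) (Fin m) (ZMod p), c M * ZMod.stdAddChar (Matrix.trace
          (M * ((1 : Matrix.GeneralLinearGroup (Fin m) (ZMod p)) : Matrix (Fin m) (Fin m) (ZMod p))))) = 1 ∧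
      ∀ a ∈ H₁, ∀ b ∈ H₂, ∀ g ∈ H₃, a * b * g ≠ 1 →
        (∑ M : Matrix (Fin m) (Fin m) (ZMod p), c M * ZMod.stdAddChar (Matrix.trace
          (M * ((a * b * g : Matrix.GeneralLinearGroup (Fin m) (ZMod p)) :
            Matrix (Fin m) (Fin m) (ZMod p))))) = 0 := by
  classical
  -- forbidden values of the statistic
  set R' : Finset ℂ := R.image fun r => ((p : ℂ)⁻¹) ^ r with hR'
  have hcard : R'.card ≤ k := le_trans Finset.card_image_le hR
  have h1 : rankStat p m 1 ∉ R' := by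
    rw [rankStat_one, hR', Finset.mem_image]
    rintro ⟨r, hr, hr1⟩
    exact inv_pow_ne_one (p := p) (fun h => h0 (h ▸ hr)) hr1
  have hx : ∀ j : ℕ, j ≤ k → ∃ c : Matrix (Fin m) (Fin m) (ZMod p) → ℂ,
      (∀ M, k < M.rank → c M = 0) ∧ ∀ g : Matrix.GeneralLinearGroup (Fin m) (ZMod p),
        rankStat p m g ^ j = ∑ M : Matrix (Fin m) (Fin m) (ZMod p),
          c M * ZMod.stdAddChar (Matrix.trace (M * (g : Matrix (Fin m) (Fin m) (ZMod p)))) :=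
    fun j hj => stub_radialMonomial hj
  obtain ⟨c, hc, hc1, hc0⟩ := stub_polyOfLevels (rankStat p m) hx R' hcard h1
  refine ⟨c, hc, hc1, fun a ha b hb g hg hne => hc0 _ ?_⟩
  rw [hR', Finset.mem_image]
  exact ⟨_, hS a ha b hb g hg hne, rfl⟩

end Radial

/-! ## The transfer targets C⁺ and the composition -/

/-- **C⁺_W = `WitnessedLieDesigns`** (line `SketchIdeator3G2`): for every `ε > 0` there are a prime `p`,
`m, a, b` and subgroups `H₁, H₂, H₃ ≤ GL_m(𝔽_p)` forming a FOUR-FOLD TPP quadruple with the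
frame–coframe stabiliser `Q_{a,b}` and beating the level-`(a+b)` graded budget:
`Σ_{χ ∈ Irr(GL_m(𝔽_p)) ∩ F_{a+b}} χ(1)^{2+ε} < (|H₁||H₂||H₃|)^{(2+ε)/3}`. -/
def WitnessedLieDesigns : Prop :=
  ∀ ε : ℝ, 0 < ε → ∃ (p : ℕ) (_ : Fact p.Prime) (m a b : ℕ) (H₁ H₂ H₃ : Subgroup (GLm p m)),
    FourFoldTPP H₁ H₂ H₃ (frameCoframeStab p m a b) ∧
      (∑ᶠ χ ∈ Literature.RepresentationTheory.FiniteGroups.irrChars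
          (Matrix.GeneralLinearGroup (Fin m) (ZMod p)) ∩ {f | IsLevel p m (a + b) f},
        (χ 1).re ^ (2 + ε)) <
        ((Nat.card H₁ * Nat.card H₂ * Nat.card H₃ : ℕ) : ℝ) ^ ((2 + ε) / 3)

/-- **C⁺_R = `SparseSpectrumDesigns`** (line `Sketch`, card `rank-spectrum-radial-separators`): for every
`ε > 0` a subgroup TPP triple in some `GL_m(𝔽_p)` whose non-trivial triple products `s` realise at most
`k` values of `rk(s-1)`, all non-zero, and which beats the level-`k` graded budget. -/
def SparseSpectrumDesigns : Prop :=
  ∀ ε : ℝ, 0 < ε → ∃ (p : ℕ) (_ : Fact p.Prime) (m k : ℕ) (H₁ H₂ H₃ : Subgroup (GLm p m))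
    (R : Finset ℕ), SubgroupTPP H₁ H₂ H₃ ∧ R.card ≤ k ∧ 0 ∉ R ∧
      (∀ a ∈ H₁, ∀ b ∈ H₂, ∀ c ∈ H₃, a * b * c ≠ 1 →
        (((a * b * c : GLm p m) : Mat p m) - 1).rank ∈ R) ∧
      (∑ᶠ χ ∈ Literature.RepresentationTheory.FiniteGroups.irrChars
          (Matrix.GeneralLinearGroup (Fin m) (ZMod p)) ∩ {f | IsLevel p m k f},
        (χ 1).re ^ (2 + ε)) <
        ((Nat.card H₁ * Nat.card H₂ * Nat.card H₃ : ℕ) : ℝ) ^ ((2 + ε) / 3)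

/-- STUB (the lead's own): one of the two transfer targets holds. -/
theorem stub_witnessedOrSparse : WitnessedLieDesigns ∨ SparseSpectrumDesigns := by
  sorry

/-- Branch W closes the crux: `WitnessedLieDesigns` + `1_{Q_{a,b}} ∈ F_{a+b}` ⇒ `SubgroupIdentityDesigns`
(take `k := a + b` and the test `f := 1_{Q_{a,b}}`). -/
theorem subgroupIdentityDesigns_of_witnessed (hW : WitnessedLieDesigns) : SubgroupIdentityDesigns := by
  intro ε hε
  obtain ⟨p, hp, m, a, b, H₁, H₂, H₃, h4, hB⟩ := hW ε hε
  obtain ⟨c, hc, hf⟩ := qInd_isLevel (p := p) (m := m) a b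
  refine ⟨p, hp, m, a + b, H₁, H₂, H₃, h4.subgroupTPP, ⟨c, hc, ?_, ?_⟩, hB⟩
  · rw [← hf 1]
    exact if_pos (frameCoframeStab p m a b).one_mem
  · intro x hx y hy z hz hne
    rw [← hf (x * y * z)]
    exact if_neg (h4.not_mem hx hy hz hne)

/-- Branch R closes the crux: `SparseSpectrumDesigns` + the radial stubs ⇒ `SubgroupIdentityDesigns`. -/
theorem subgroupIdentityDesigns_of_sparse (hR : SparseSpectrumDesigns) : SubgroupIdentityDesigns := by
  intro ε hε
  obtain ⟨p, hp, m, k, H₁, H₂, H₃, R, hT, hRk, h0, hS, hB⟩ := hR ε hε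
  obtain ⟨c, hc, hc1, hc0⟩ := identityTest_of_sparseSpectrum (p := p) (m := m) H₁ H₂ H₃ R hRk h0 hS
  exact ⟨p, hp, m, k, H₁, H₂, H₃, hT, ⟨c, hc, hc1, hc0⟩, hB⟩

/-- **The line closes the crux BY NAME** from the registered stubs. -/
theorem SubgroupIdentityDesigns_of : SubgroupIdentityDesigns :=
  stub_witnessedOrSparse.elim subgroupIdentityDesigns_of_witnessed subgroupIdentityDesigns_of_sparse

end Summit.MatrixMultiplication.MatrixMultiplication.Theorems.Witnessed
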